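import Literature.NumberTheory.EllipticCurves.ShaRestriction
import Literature.NumberTheory.EllipticCurves.GaloisActionProofs
import Literature.NumberTheory.EllipticCurves.HeegnerPoints
import Literature.NumberTheory.GaloisRepresentations.AbsGaloisGroup
import Mathlib.FieldTheory.PrimitiveElement
import Mathlib.LinearAlgebra.Dual.Lemmas
import Mathlib.Data.Fintype.Pigeonhole
import HarnessLib

/-!
# No `p`-torsion over a quadratic field under a surjective mod-`p` Galois representation

Sibling proof file for the decomposition of Kolyvagin's theorem (`Literature.NumberTheory.EllipticCurves.kolyvagin`,
`Literature.NumberTheory.EllipticCurves.HeegnerPoints`) along B. H. Gross, *Kolyvagin's work on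
modular elliptic curves* (LMS Lecture Note Ser. 153, 1991), file
`HeegnerPointsKolyvaginProofs.lean`. It proves the claim of Gross's §2, the sentence following
(2.2): *"By our hypothesis on `ℚ(E_p)`* [its Galois group is `GL₂(ℤ/pℤ)`, `p` odd] *the group
`E(K)` contains no `p`-torsion"*, for an elliptic curve `E/ℚ` and a quadratic field `K`
(there: imaginary quadratic), which is the named fact `Literature.Gross1991_torsionBy_eq_bot` of that
decomposition:

* `Literature.NumberTheory.EllipticCurves.torsionBy_eq_bot_of_hasSurjectiveModNGaloisRep`: for `W/ℚ` elliptic, `[K : ℚ] = 2`,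
  `p` an odd prime with `ρ̄_{E,p} : Γ_ℚ → Aut(E[p])` onto
  (`WeierstrassCurve.HasSurjectiveModNGaloisRep`), `E(K)[p] = 0`;
* `Literature.NumberTheory.EllipticCurves.torsionBy_eq_bot_of_isImaginaryQuadratic`: the same under `Literature.IsImaginaryQuadratic K`,
  i.e. literally the body of `Literature.Gross1991_torsionBy_eq_bot W K` (whose one-line discharge
  `Gross1991_torsionBy_eq_bot_holds` is appended to `HeegnerPointsKolyvaginProofs.lean`).

## The argument (not printed by Gross; standard)

Suppose `0 ≠ P ∈ E(K)[p]`. Over `K̄` the point `P` is fixed by `Γ_K`; pulling back along the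
tree's identification `E(ℚ̄) ≅ E(K̄)` (`Literature.NumberTheory.EllipticCurves.pointsMap`, bijective: `Literature.NumberTheory.EllipticCurves.pointsMapOfEmb_bijective`,
equivariant for the restriction `Literature.resGal : Γ_K → Γ_ℚ`) gives `0 ≠ Q ∈ E[p] = E(ℚ̄)[p]`
fixed by `res(Γ_K)`. Since `[K : ℚ] = 2` there are exactly two `ℚ`-embeddings `K → ℚ̄`
(Mathlib `AlgHom.card`), so for every `σ ∈ Γ_ℚ` two of `ι₀, σι₀, σ²ι₀` coincide and `σ²`
fixes the embedded copy of `K`, hence is a restriction from `Γ_K`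
(`Literature.NumberTheory.EllipticCurves.exists_resGal_eq_mul_self`, transport of structure along `ℚ̄ ≅ K̄`): all squares of
`Γ_ℚ` fix `Q`. As `ρ̄` is onto, `g² Q = Q` for every `g ∈ Aut(E[p])`. But `E[p] ≅ (ℤ/pℤ)²`
(`#E[p] = p²`, Silverman III.6.4(b), tree `WeierstrassCurve.card_torsionPoints_eq_sq_holds`)
and for `p` odd a transvection `g = 1 + λ(·)w` with `λ(Q) = 1`, `λ(w) = 0`, `w ≠ 0` has
`g² Q = Q + 2w ≠ Q` (`Literature.NumberTheory.EllipticCurves.exists_addAut_apply_apply_ne`) — a contradiction. (Equivalently: a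
subgroup of index `≤ 2` of `GL₂(𝔽_p)`, `p` odd, contains `SL₂(𝔽_p)` and fixes no non-zero
vector.) The statement for `K : Type u` is descended to the tree's `Type`-valued constructions
through a primitive element (`Literature.NumberTheory.EllipticCurves.exists_algEquiv_numberField_type`).

## References

* B. H. Gross, *Kolyvagin's work on modular elliptic curves*, in *`L`-functions and arithmetic
  (Durham, 1989)*, LMS Lecture Note Ser. 153 (1991), §2, sentence after (2.2). [GrossLMS1991]
* J.-P. Serre, *Propriétés galoisiennes des points d'ordre fini des courbes elliptiques*,
  Invent. Math. 15 (1972), §4 (the image of `ρ̄_{E,p}`). [Serre1972]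
* J. H. Silverman, *The Arithmetic of Elliptic Curves*, 2nd ed., GTM 106 (2009), III.6.4(b),
  III.§7, VIII.§1. [SilvermanAEC2009]
-/

noncomputable section

open scoped Classical IntermediateField

universe u

namespace Literature.NumberTheory.EllipticCurves

open Field (absoluteGaloisGroup)
open Field.absoluteGaloisGroup (toAlgEquiv)

/-! ## Linear algebra in `E[p] ≅ (ℤ/pℤ)²` -/

section GroupTheory

/-- In an elementary abelian `p`-group `M` of order `p²` (`p` an odd prime), no non-zero element
is fixed by the squares of all automorphisms: for `Q ≠ 0` there is `g ∈ Aut(M)` with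
`g (g Q) ≠ Q` (a transvection `g = 1 + λ(·) w` with `λ Q = 1`, `λ w = 0`, `w ≠ 0`, for which
`g² Q = Q + 2w`). [folklore] -/
theorem exists_addAut_apply_apply_ne {M : Type*} [AddCommGroup M] {p : ℕ} [hp : Fact p.Prime]
    (hp2 : p ≠ 2) [Module (ZMod p) M] [Finite M] (hcard : Nat.card M = p ^ 2) {Q : M}
    (hQ : Q ≠ 0) : ∃ g : AddAut M, g (g Q) ≠ Q := by
  obtain ⟨lam, hlam⟩ := Module.Projective.exists_dual_eq_one (ZMod p) hQ
  haveI : Fintype M := Fintype.ofFinite M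
  have hlt : Fintype.card (ZMod p) < Fintype.card M := by
    rw [ZMod.card, Fintype.card_eq_nat_card, hcard]
    calc p = p ^ 1 := (pow_one p).symm
      _ < p ^ 2 := Nat.pow_lt_pow_right hp.out.one_lt (by norm_num)
  obtain ⟨x, y, hxy, hfxy⟩ := Fintype.exists_ne_map_eq_of_card_lt lam hlt
  set w := x - y with hw
  have hw0 : w ≠ 0 := sub_ne_zero.mpr hxy
  have hlw : lam w = 0 := by rw [hw, map_sub, hfxy, sub_self]
  let f : M →ₗ[ZMod p] M := lam.smulRight w
  have hf : ∀ m, f m = lam m • w := fun m ↦ rfl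
  have hff : ∀ m, f (f m) = 0 := fun m ↦ by rw [hf, hf, map_smul, hlw, smul_eq_mul, mul_zero, zero_smul]
  let g : M ≃+ M :=
    { toFun := fun m ↦ m + f m
      invFun := fun m ↦ m - f m
      left_inv := fun m ↦ by
        show m + f m - f (m + f m) = m
        rw [map_add, hff, add_zero, add_sub_cancel_right]
      right_inv := fun m ↦ by
        show m - f m + f (m - f m) = m
        rw [map_sub, hff, sub_zero, sub_add_cancel]
      map_add' := fun a b ↦ by
        show a + b + f (a + b) = a + f a + (b + f b)
        rw [map_add]
        abel }
  refine ⟨g, fun h ↦ hw0 ?_⟩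
  have hgQ : g Q = Q + w := by
    show Q + f Q = Q + w
    rw [hf, hlam, one_smul]
  have hggQ : g (g Q) = Q + w + w := by
    rw [hgQ]
    show Q + w + f (Q + w) = Q + w + w
    rw [map_add, hf, hf, hlam, hlw, one_smul, zero_smul, add_zero]
  rw [hggQ, add_assoc, add_eq_left, ← two_smul (ZMod p)] at h
  have h2 : (2 : ZMod p) ≠ 0 := by
    intro h2
    have : ((2 : ℕ) : ZMod p) = 0 := by exact_mod_cast h2
    rw [ZMod.natCast_eq_zero_iff] at this
    exact hp2 ((Nat.prime_dvd_prime_iff_eq hp.out Nat.prime_two).mp this)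
  exact (smul_eq_zero.mp h).resolve_left h2

end GroupTheory

/-! ## Squares of `Γ_ℚ` restrict from `Γ_K` for `[K : ℚ] = 2` -/

section SquaresInRange

variable (K : Type) [Field K] [NumberField K]

/-- An element of `Γ_ℚ` fixing pointwise the embedded copy `e⁻¹(K) ⊂ ℚ̄` of `K`, where
`e : ℚ̄ ≃ K̄` is the chosen identification (`closureEmb K`, bijective since `K/ℚ` is algebraic:
`algEquivOfEmb`), is the restriction of an element of `Γ_K = Gal(K̄/K)` along `e` (transport of
structure: `e ∘ ρ ∘ e⁻¹` is `K`-linear). Serre, *Galois Cohomology*, II.§1.1. [folklore] -/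
theorem exists_resGal_eq_of_forall_apply_eq {ρ : absoluteGaloisGroup ℚ}
    (hρ : ∀ x : K, toAlgEquiv ℚ ρ ((algEquivOfEmb K (closureEmb (K := ℚ) K)).symm
        (algebraMap K (AlgebraicClosure K) x)) =
      (algEquivOfEmb K (closureEmb (K := ℚ) K)).symm (algebraMap K (AlgebraicClosure K) x)) :
    ∃ τ : absoluteGaloisGroup K, resGal (K := ℚ) K τ = ρ := by
  set e := algEquivOfEmb K (closureEmb (K := ℚ) K) with he
  let τ₀ : AlgebraicClosure K ≃ₐ[ℚ] AlgebraicClosure K := e.symm.trans ((toAlgEquiv ℚ ρ).trans e)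
  have hτ₀ : ∀ x : K, τ₀ (algebraMap K (AlgebraicClosure K) x) =
      algebraMap K (AlgebraicClosure K) x := by
    intro x
    show e (toAlgEquiv ℚ ρ (e.symm (algebraMap K _ x))) = algebraMap K _ x
    rw [hρ x, e.apply_symm_apply]
  let τ : AlgebraicClosure K ≃ₐ[K] AlgebraicClosure K :=
    AlgEquiv.ofRingEquiv (f := τ₀.toRingEquiv) hτ₀
  refine ⟨(toAlgEquiv K).symm τ, ?_⟩
  suffices h : toAlgEquiv ℚ (resGal (K := ℚ) K ((toAlgEquiv K).symm τ)) = toAlgEquiv ℚ ρ from h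
  refine AlgEquiv.ext fun x ↦ ?_
  apply (algHom_algebraicClosure_bijective K (closureEmb (K := ℚ) K)).1
  have h2 := apply_resGalAuxOfEmb_apply (closureEmb (K := ℚ) K) ((toAlgEquiv K).symm τ) x
  refine h2.trans ?_
  show e (toAlgEquiv ℚ ρ (e.symm (e x))) = e (toAlgEquiv ℚ ρ x)
  rw [e.symm_apply_apply]

/-- For `[K : ℚ] = 2`, the square of every element of `Γ_ℚ` is a restriction from `Γ_K`
(`Γ_K` has index `2` in `Γ_ℚ`; here through the two `ℚ`-embeddings `K → ℚ̄`, Mathlib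
`AlgHom.card`: among `ι₀, σι₀, σ²ι₀`, `ι₀ = e⁻¹|_K`, two coincide, and
`exists_resGal_eq_of_forall_apply_eq`). [folklore] -/
theorem exists_resGal_eq_mul_self (hK : Module.finrank ℚ K = 2) (σ : absoluteGaloisGroup ℚ) :
    ∃ τ : absoluteGaloisGroup K, resGal (K := ℚ) K τ = σ * σ := by
  let ι₀ : K →ₐ[ℚ] AlgebraicClosure ℚ :=
    (algEquivOfEmb K (closureEmb (K := ℚ) K)).symm.toAlgHom.comp
      (algebraMap K (AlgebraicClosure K)).toRatAlgHom
  let c : absoluteGaloisGroup ℚ → (K →ₐ[ℚ] AlgebraicClosure ℚ) := fun ρ ↦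
    (toAlgEquiv ℚ ρ).toAlgHom.comp ι₀
  have hc : ∀ (ρ : absoluteGaloisGroup ℚ) (x : K), c ρ x = toAlgEquiv ℚ ρ (ι₀ x) :=
    fun _ _ ↦ rfl
  have key : ∀ ρ : absoluteGaloisGroup ℚ, c ρ = c 1 →
      ∃ τ : absoluteGaloisGroup K, resGal (K := ℚ) K τ = ρ := by
    intro ρ h
    refine exists_resGal_eq_of_forall_apply_eq K fun x ↦ ?_
    have := congr($h x)
    rw [hc, hc, map_one, AlgEquiv.one_apply] at this
    exact this
  have card : Nat.card (K →ₐ[ℚ] AlgebraicClosure ℚ) = 2 := by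
    rw [← hK, ← AlgHom.card ℚ K (AlgebraicClosure ℚ), Fintype.card_eq_nat_card]
  by_cases h1 : c σ = c 1
  · obtain ⟨τ, hτ⟩ := key σ h1
    exact ⟨τ * τ, by rw [map_mul, hτ]⟩
  by_cases h2 : c (σ * σ) = c 1
  · exact key _ h2
  by_cases h3 : c (σ * σ) = c σ
  · exfalso
    apply h1
    apply AlgHom.ext
    intro x
    have := congr($h3 x)
    rw [hc, hc, map_mul, AlgEquiv.mul_apply] at this
    rw [hc, hc, map_one, AlgEquiv.one_apply]
    exact (toAlgEquiv ℚ σ).injective this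
  exfalso
  have hle := Finset.card_le_univ ({c 1, c σ, c (σ * σ)} : Finset (K →ₐ[ℚ] AlgebraicClosure ℚ))
  rw [Fintype.card_eq_nat_card, card, Finset.card_insert_of_notMem,
    Finset.card_insert_of_notMem, Finset.card_singleton] at hle
  · omega
  · simpa using fun h ↦ h3 h.symm
  · simp only [Finset.mem_insert, Finset.mem_singleton, not_or]
    exact ⟨fun h ↦ h1 h.symm, fun h ↦ h2 h.symm⟩

end SquaresInRange

/-! ## `E(K)[p] = 0` -/

section Torsion

variable (K : Type) [Field K] [NumberField K] (W : WeierstrassCurve ℚ) [W.IsElliptic]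

/-- **`E(K)[p] = 0` for a quadratic number field `K` (in `Type`) when `ρ̄_{E,p}` is onto and `p`
is odd** — the claim of Gross 1991, §2 (sentence after (2.2)), by the argument of the module
docstring: pull a `K`-rational `p`-torsion point back to `0 ≠ Q ∈ E[p]` fixed by `res(Γ_K)`,
hence by all squares of `Γ_ℚ` (`exists_resGal_eq_mul_self`), hence by `g²` for every
`g ∈ Aut(E[p])` (`ρ̄` onto), contradicting `exists_addAut_apply_apply_ne` (`#E[p] = p²`,
`card_torsionPoints_eq_sq_holds`). The universe-polymorphic statement is
`torsionBy_eq_bot_of_hasSurjectiveModNGaloisRep` below.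
[cite: GrossLMS1991, §2 (sentence after (2.2))] -/
theorem torsionBy_eq_bot_of_hasSurjectiveModNGaloisRep_type (hK : Module.finrank ℚ K = 2) {p : ℕ}
    (hp : p.Prime) (hp2 : p ≠ 2) (hρ : W.HasSurjectiveModNGaloisRep p) :
    AddSubgroup.torsionBy (W.baseChange K).toAffine.Point (p : ℤ) = ⊥ := by
  rw [eq_bot_iff]
  intro P hP
  rw [AddSubgroup.mem_bot]
  by_contra hP0
  have hPp : p • P = 0 := AddSubgroup.torsionBy.nsmul_iff.mp hP
  -- the point over `K̄` and its preimage `Q` over `ℚ̄`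
  let f : K →ₐ[ℚ] AlgebraicClosure K := (algebraMap K (AlgebraicClosure K)).toRatAlgHom
  let φ : (W.baseChange K).toAffine.Point →+ localPoints W K :=
    WeierstrassCurve.Affine.Point.map f
  have hφ : Function.Injective φ := WeierstrassCurve.Affine.Point.map_injective _
  obtain ⟨Q, hQ⟩ := (pointsMapOfEmb_bijective K W (closureEmb (K := ℚ) K)).2 (φ P)
  have hQ' : pointsMap W K Q = φ P := hQ
  have hinj : Function.Injective (pointsMap W K) :=
    (pointsMapOfEmb_bijective K W (closureEmb (K := ℚ) K)).1
  have hQ0 : Q ≠ 0 := by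
    rintro rfl
    apply hP0
    apply hφ
    rw [map_zero, ← hQ', map_zero]
  have hQp : p • Q = 0 := by
    apply hinj
    rw [map_nsmul, map_zero, hQ', ← map_nsmul, hPp, map_zero]
  -- `Q` is fixed by `Γ_K`
  have hfixK : ∀ τ : absoluteGaloisGroup K, resGal (K := ℚ) K τ • Q = Q := by
    intro τ
    apply hinj
    rw [pointsMap_smul, hQ']
    change WeierstrassCurve.Affine.Point.map
        ((AlgEquiv.restrictScalars ℚ (toAlgEquiv K τ) :
            AlgebraicClosure K ≃ₐ[ℚ] AlgebraicClosure K) :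
          AlgebraicClosure K →ₐ[ℚ] AlgebraicClosure K)
        (WeierstrassCurve.Affine.Point.map f P) =
      WeierstrassCurve.Affine.Point.map f P
    have hgf : ((AlgEquiv.restrictScalars ℚ (toAlgEquiv K τ) :
            AlgebraicClosure K ≃ₐ[ℚ] AlgebraicClosure K) :
          AlgebraicClosure K →ₐ[ℚ] AlgebraicClosure K).comp f = f := by
      ext x
      exact (toAlgEquiv K τ).commutes x
    rw [WeierstrassCurve.Affine.Point.map_map, hgf]
  -- hence by all squares of `Γ_ℚ`
  have hsq : ∀ σ : absoluteGaloisGroup ℚ, (σ * σ) • Q = Q := by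
    intro σ
    obtain ⟨τ, hτ⟩ := exists_resGal_eq_mul_self K hK σ
    rw [← hτ]
    exact hfixK τ
  -- the group theory in `E[p]`
  haveI : Fact p.Prime := ⟨hp⟩
  let M := ↥(WeierstrassCurve.geomTorsion W (p : ℤ))
  letI : Module (ZMod p) M := AddSubgroup.torsionBy.zmodModule
  have hcardM : Nat.card M = p ^ 2 := by
    have := WeierstrassCurve.card_torsionPoints_eq_sq_holds W (AlgebraicClosure ℚ) (n := p)
      (by exact_mod_cast hp.ne_zero)
    exact this
  haveI : Finite M := Nat.finite_of_card_ne_zero (by rw [hcardM]; exact pow_ne_zero _ hp.ne_zero)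
  let Qm : M := ⟨Q, AddSubgroup.torsionBy.nsmul_iff.mpr hQp⟩
  have hQm0 : Qm ≠ 0 := fun h ↦ hQ0 (congrArg Subtype.val h)
  obtain ⟨g, hg⟩ := exists_addAut_apply_apply_ne hp2 hcardM hQm0
  obtain ⟨σ, hσ⟩ := (show Function.Surjective _ from hρ) (Multiplicative.ofAdd g)
  apply hg
  have hgσ : ∀ R : M, g R = σ • R := fun R ↦ by
    have := WeierstrassCurve.galoisRepTorsion_apply (W := W) (p : ℤ) σ R
    rw [hσ, toAdd_ofAdd] at this
    exact this
  rw [hgσ, hgσ, ← mul_smul]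
  apply Subtype.ext
  exact hsq σ

end Torsion

/-! ## Universe descent and the statements for `K : Type u` -/

section Universe

/-- Every number field is `ℚ`-isomorphic to a number field in `Type` (primitive element `θ`:
`K ≅ ℚ[X]/(minpoly θ)`); used to descend universe-polymorphic statements to the tree's
`Type`-valued Galois-cohomological constructions. [folklore] -/
theorem exists_algEquiv_numberField_type (K : Type u) [Field K] [NumberField K] :
    ∃ (K₀ : Type) (_ : Field K₀) (_ : NumberField K₀), Nonempty (K₀ ≃ₐ[ℚ] K) := by
  obtain ⟨θ, hθ⟩ := Field.exists_primitive_element ℚ K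
  have hint : IsIntegral ℚ θ := Algebra.IsIntegral.isIntegral θ
  haveI : Fact (Irreducible (minpoly ℚ θ)) := ⟨minpoly.irreducible hint⟩
  let e₁ : AdjoinRoot (minpoly ℚ θ) ≃ₐ[ℚ] ℚ⟮θ⟯ := IntermediateField.adjoinRootEquivAdjoin ℚ hint
  let e₂ : (ℚ⟮θ⟯ : IntermediateField ℚ K) ≃ₐ[ℚ] K :=
    (IntermediateField.equivOfEq hθ).trans IntermediateField.topEquiv
  haveI : CharZero (AdjoinRoot (minpoly ℚ θ)) :=
    charZero_of_injective_algebraMap (algebraMap ℚ _).injective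
  haveI : FiniteDimensional ℚ (AdjoinRoot (minpoly ℚ θ)) :=
    Module.Finite.equiv (e₁.trans e₂).symm.toLinearEquiv
  exact ⟨AdjoinRoot (minpoly ℚ θ), inferInstance, ⟨⟩, ⟨e₁.trans e₂⟩⟩

/-- Transport of "`E(K)[p] = 0`" along a `ℚ`-algebra isomorphism of the field of definition
(the induced map on points is an injective homomorphism). [folklore] -/
theorem torsionBy_eq_bot_of_algEquiv (W : WeierstrassCurve ℚ) {K : Type u} [Field K]
    [NumberField K] {K₀ : Type} [Field K₀] [NumberField K₀] (e : K₀ ≃ₐ[ℚ] K) {p : ℕ}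
    (h₀ : AddSubgroup.torsionBy (W.baseChange K₀).toAffine.Point (p : ℤ) = ⊥) :
    AddSubgroup.torsionBy (W.baseChange K).toAffine.Point (p : ℤ) = ⊥ := by
  rw [eq_bot_iff]
  intro P hP
  rw [AddSubgroup.mem_bot]
  let ψ : (W.baseChange K).toAffine.Point →+ (W.baseChange K₀).toAffine.Point :=
    WeierstrassCurve.Affine.Point.map e.symm.toAlgHom
  have hψ : Function.Injective ψ := WeierstrassCurve.Affine.Point.map_injective _
  apply hψ
  rw [map_zero]
  have : ψ P ∈ AddSubgroup.torsionBy (W.baseChange K₀).toAffine.Point (p : ℤ) := by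
    apply AddSubgroup.torsionBy.nsmul_iff.mpr
    rw [← map_nsmul, AddSubgroup.torsionBy.nsmul_iff.mp hP, map_zero]
  rw [h₀] at this
  exact (AddSubgroup.mem_bot).mp this

/-- **`E(K)[p] = 0` for a quadratic number field `K` when `ρ̄_{E,p}` is onto and `p` is odd**
(Gross 1991, §2, sentence after (2.2): *"By our hypothesis on `ℚ(E_p)`, the group `E(K)`
contains no `p`-torsion"*), for `K` in any universe: `torsionBy_eq_bot_of_hasSurjectiveModNGaloisRep_type`
for a `ℚ`-isomorphic model of `K` in `Type` (`exists_algEquiv_numberField_type`), transported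
by `torsionBy_eq_bot_of_algEquiv`. [cite: GrossLMS1991, §2 (sentence after (2.2))] -/
theorem torsionBy_eq_bot_of_hasSurjectiveModNGaloisRep (W : WeierstrassCurve ℚ) [W.IsElliptic]
    (K : Type u) [Field K] [NumberField K] (hK : Module.finrank ℚ K = 2) {p : ℕ} (hp : p.Prime)
    (hp2 : p ≠ 2) (hρ : W.HasSurjectiveModNGaloisRep p) :
    AddSubgroup.torsionBy (W.baseChange K).toAffine.Point (p : ℤ) = ⊥ := by
  obtain ⟨K₀, _, _, ⟨e⟩⟩ := exists_algEquiv_numberField_type K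
  have hK₀ : Module.finrank ℚ K₀ = 2 := by rw [← hK]; exact e.toLinearEquiv.finrank_eq
  exact torsionBy_eq_bot_of_algEquiv W e
    (torsionBy_eq_bot_of_hasSurjectiveModNGaloisRep_type K₀ W hK₀ hp hp2 hρ)

/-- **Gross 1991, §2 (sentence after (2.2)) as vendored in the decomposition of Kolyvagin's
theorem**: for `W/ℚ` elliptic, `K` an imaginary quadratic field (`Literature.IsImaginaryQuadratic K`),
`p` an odd prime with `ρ̄_{E,p}` onto, `E(K)[p] = 0`. This is literally the body of the named
fact `Literature.Gross1991_torsionBy_eq_bot W K` of `HeegnerPointsKolyvaginProofs.lean` (only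
`[K : ℚ] = 2` is used). [cite: GrossLMS1991, §2 (sentence after (2.2))] -/
theorem torsionBy_eq_bot_of_isImaginaryQuadratic (W : WeierstrassCurve ℚ) [W.IsElliptic]
    (K : Type u) [Field K] [NumberField K] (hK : IsImaginaryQuadratic K) {p : ℕ} (hp : p.Prime)
    (hp2 : p ≠ 2) (hρ : W.HasSurjectiveModNGaloisRep p) :
    AddSubgroup.torsionBy (W.baseChange K).toAffine.Point (p : ℤ) = ⊥ :=
  torsionBy_eq_bot_of_hasSurjectiveModNGaloisRep W K hK.1 hp hp2 hρ

end Universe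

end Literature.NumberTheory.EllipticCurves
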